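import Literature.NumberTheory.GaloisRepresentations.LocalReciprocityLimitProofs
import Literature.NumberTheory.GaloisRepresentations.WeilGroupDensityProofs
import Literature.NumberTheory.GaloisRepresentations.LocalClassFieldTheoryProofs
import Literature.NumberTheory.GaloisRepresentations.LocalExistenceLubinTate
import Mathlib.Topology.Algebra.ClopenNhdofOne
import Mathlib.Topology.MetricSpace.Ultra.TotallySeparated
import Mathlib.Topology.Algebra.Valued.NormedValued
import Mathlib.NumberTheory.Cyclotomic.Basic
import HarnessLib

/-!
# From the finite-level reciprocity system to the reciprocity map `θ_F` — part 2: the printed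
properties of `θ_F` (Serre XIV §6 Cor. 2, Remark 2) and norm functoriality in the limit

Part 1 (`LocalReciprocityLimitProofs.lean`) constructs from a reciprocity system `ω`
(`Literature.IsReciprocitySystem F ω`: the finite-level norm residue symbols with their printed
properties, Serre XIII §4) the limit map `θ = IsReciprocitySystem.theta hω : Fˣ →* Γ_F^ab`.  This
file derives the printed properties of `θ` (`Literature.NumberTheory.GaloisRepresentations.IsLocalReciprocityMap`, file `LocalReciprocity`)
and closes the decomposition of `Literature.NumberTheory.GaloisRepresentations.exists_isCompatible` down to the finite level:

* `IsReciprocitySystem.isLocalReciprocityMap_theta`: given that the universal norm group is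
  trivial (`universalNormSubgroup F = ⊥`, Serre XIV §6 Cor. 2 (i)) and that norm groups are
  closed (`isClosed_of_isNormSubgroup F`, XIV §6 axiom III-1 — PROVED in the tree,
  `isClosed_of_isNormSubgroup_holds` of `LocalExistenceTheoremProofs.lean`, and fed in the final
  assembly theorems), `θ` is injective, has image `[W_F]`, maps `U_F` onto `[I_F]` homeomorphically,
  and sends uniformisers to arithmetic Frobenius classes;
* `IsReciprocitySystem.isNormCompatible_theta`: the norm-compatibility clause of the pair fact
  gives `θ_F ∘ N_{E/F} = i ∘ θ_E` (`Literature.NumberTheory.GaloisRepresentations.IsNormCompatible`);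
* `exists_isLocalReciprocityMap(_normCompatible)_of_isReciprocitySystem`,
  `exists_isCompatible_of_isReciprocitySystem`: the facts of `LocalReciprocity.lean`, hence
  `Literature.NumberTheory.GaloisRepresentations.exists_isCompatible`, from `exists_isReciprocitySystem(_normCompatible)` and the two
  norm-group inputs.

## Proofs

* Uniformisers (`mul_inv_mem_absInertia_of_mem_reps`, `isFrobPow_one_of_mem_reps`): a
  representative `γ` of `θ ϖ` and an arithmetic Frobenius `φ` (`exists_isAbsArithFrob_holds`)
  agree on every `F(ζ)`, `ζ` a root of unity of order prime to `p` — these are finite abelian and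
  fixed by `I_F` (`adjoin_rootOfUnity_finite_abelian_unramified`: cyclotomic extensions are abelian,
  Mathlib; roots of unity of order prime to `p` are distinct modulo `𝔓`,
  `eq_of_pow_eq_one_of_sub_mem_absMaximalIdeal`) — by `unramified_uniformizer`; and an element
  fixing all such `ζ` lies in `I_F` (`mem_absInertia_of_forall_rootOfUnity`, because every residue
  is `0` or the residue of such a `ζ`: `mem_or_exists_rootOfUnity_sub_mem`, using the degree
  bound `mk_pow_residueFieldCard_pow_factorial_index` of `WeilGroupDensityProofs`).
* Units (`map_unitGroup_theta`): `θ(U_F) ≤ [I_F]` by a compactness argument in `I_F` from the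
  finite-level clause `map_unitGroup` and `compatible`; `≥` by the same argument in the compact
  `U_F`, which needs the conditions `ω_L u = i|_L` to be closed, i.e. `N_L` closed.
* Injectivity: `ker θ = ⋂_L N_L` (`mem_ker_theta_iff`).
* Continuity of `θ` (`continuous_theta`): a neighbourhood of `1` in `Γ_F^ab` contains the image
  of an open normal `V ≤ Γ_F`; `closure [Γ_F,Γ_F] · V = Gal(F̄/L)` for a finite abelian `L`
  (`AbsGaloisGroupOpenNormal`), and `θ(N_L) ⊆ [V]`; with `N_L` open (closed of finite index).
  Then `U_F → Γ_F^ab` is a closed embedding (compact source, Hausdorff target).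
* Image (`range_theta_eq`): `x = u ϖⁿ`, `θ u ∈ [I_F] ⊆ [W_F]`, `θ ϖ = [γ]` with `γ` a Frobenius
  element of `W_F`; conversely `w ∈ W_F` of degree `n` is `i γⁿ` modulo `closure [Γ_F, Γ_F]`.

## References

* J.-P. Serre, *Local Fields*, GTM 67, Springer 1979, Ch. XIII §4 (Prop. 10, Prop. 13 and
  Cor.), Ch. XIV §6 (Thm. 1 and its proof, Cor. 1–2, Remark 2); Ch. IV §4 (roots of unity).
  [SerreLocalFields1979]
* J.-P. Serre, *Local class field theory*, Ch. VI of Cassels–Fröhlich (1967), §2.3–2.5.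
  [CasselsFrohlichANT1967]
* J. Tate, *Number theoretic background* (Corvallis 1979), (1.4.1).  [Corvallis1979]
-/

noncomputable section

open ValuativeRel Field

namespace Literature.NumberTheory.GaloisRepresentations

open GaloisRepresentations.IsNonarchimedeanLocalField

/-! ### Units and uniformisers -/

/-- Every `x ∈ Fˣ` is `u * ϖ ^ n` with `u` a unit of `𝒪_F` and `n ∈ ℤ`, for any uniformiser `ϖ`.
Ref: Serre, *Local Fields* (1979), Ch. II §1. [folklore] -/
theorem exists_unitGroup_mul_zpow {F : Type*} [Field F] [ValuativeRel F] [TopologicalSpace F]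
    [IsNonarchimedeanLocalField F] {ϖ : Fˣ} (hϖ : (valuation F).IsUniformizer (ϖ : F)) (x : Fˣ) :
    ∃ (u : Fˣ) (n : ℤ), u ∈ (valuation F).valuationSubring.unitGroup ∧ x = u * ϖ ^ n := by
  have hx0 : valuation F (x : F) ≠ 0 := by simp
  have hmem : Units.mk0 (valuation F (x : F)) hx0 ∈
      MonoidWithZeroHom.valueGroup (MonoidWithZeroHom.ofClass (valuation F)) :=
    MonoidWithZeroHom.mem_valueGroup _ ⟨(x : F), rfl⟩
  rw [← Valuation.IsRankOneDiscrete.generator_zpowers_eq_valueGroup, Subgroup.mem_zpowers_iff]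
    at hmem
  obtain ⟨n, hn⟩ := hmem
  refine ⟨x * ϖ ^ (-n), n, ?_, by group⟩
  rw [Valuation.mem_unitGroup_iff, Units.val_mul, Units.val_zpow_eq_zpow_val, map_mul, map_zpow₀,
    hϖ.val]
  have hx : valuation F (x : F) =
      (Valuation.IsRankOneDiscrete.generator (valuation F) : _) ^ n := by
    have := congr(((↑) : (ValueGroupWithZero F)ˣ → ValueGroupWithZero F) $hn)
    simpa using this.symm
  rw [hx, ← zpow_add₀ (Valuation.IsRankOneDiscrete.generator_ne_zero _), add_neg_cancel,
    zpow_zero]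


/-! ### Roots of unity of order prime to `p` and the inertia group -/

section RootsOfUnity

open Polynomial Finset

variable (F : Type*) [Field F] [ValuativeRel F] [TopologicalSpace F] [IsNonarchimedeanLocalField F]

/-- A natural number prime to the residue characteristic `p` is non-zero in `F` (else it would
vanish in `𝓀[F]`).  Ref: Serre, *Local Fields* (1979), Ch. II §1. [folklore] -/
theorem natCast_ne_zero_of_not_dvd {m : ℕ} (hm : ¬ ringChar 𝓀[F] ∣ m) : (m : F) ≠ 0 := by
  intro h
  have h1 : (m : 𝒪[F]) = 0 := Subtype.ext (by simpa using h)
  have h2 : (m : 𝓀[F]) = 0 := by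
    rw [← map_natCast (IsLocalRing.residue 𝒪[F]) m, h1, map_zero]
  exact hm ((ringChar.spec 𝓀[F] m).mp h2)

/-- A natural number prime to `p` is not in `𝔓` (as `𝔓 ∩ 𝒪[F] = 𝓂[F]`).
Ref: Serre, *Local Fields* (1979), Ch. II §1. [folklore] -/
theorem natCast_notMem_absMaximalIdeal {m : ℕ} (hm : ¬ ringChar 𝓀[F] ∣ m) :
    (m : absIntegers 𝒪[F] F) ∉ absMaximalIdeal F := by
  intro h
  have h1 : (m : 𝒪[F]) ∈ (absMaximalIdeal F).under 𝒪[F] := by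
    rw [Ideal.under_def, Ideal.mem_comap, map_natCast]
    exact h
  rw [under_absMaximalIdeal_holds F, ← IsLocalRing.residue_eq_zero_iff, map_natCast] at h1
  exact hm ((ringChar.spec 𝓀[F] m).mp h1)

/-- **Roots of unity of order prime to `p` are distinct modulo `𝔓`**: if `ζ₁ ^ m = ζ₂ ^ m = 1`
with `p ∤ m` and `ζ₁ ≡ ζ₂ (mod 𝔓)` then `ζ₁ = ζ₂` (for `η = ζ₁/ζ₂`:
`(η - 1)(1 + η + ⋯ + η^{m-1}) = 0` with the second factor `≡ m ≢ 0`).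
Ref: Serre, *Local Fields* (1979), Ch. IV §4, Prop. 16 / Ch. I §7 (roots of unity of order
prime to `p` inject into the residue field). [folklore] -/
theorem eq_of_pow_eq_one_of_sub_mem_absMaximalIdeal {m : ℕ} (hm : ¬ ringChar 𝓀[F] ∣ m)
    (hm0 : m ≠ 0) {ζ₁ ζ₂ : absIntegers 𝒪[F] F} (h₁ : ζ₁ ^ m = 1) (h₂ : ζ₂ ^ m = 1)
    (h : ζ₁ - ζ₂ ∈ absMaximalIdeal F) : ζ₁ = ζ₂ := by
  obtain ⟨k, rfl⟩ := Nat.exists_eq_succ_of_ne_zero hm0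
  -- `η = ζ₁ ζ₂^k` (`= ζ₁ / ζ₂`): `η ^ (k+1) = 1`, `η - 1 = (ζ₁ - ζ₂) ζ₂^k ∈ 𝔓`
  set η := ζ₁ * ζ₂ ^ k with hη
  have hηm : η ^ (k + 1) = 1 := by
    rw [hη, mul_pow, ← pow_mul, mul_comm k, pow_mul, h₁, h₂, one_pow, mul_one]
  have hη1 : η - 1 = (ζ₁ - ζ₂) * ζ₂ ^ k := by
    rw [sub_mul, ← pow_succ', h₂]
  have hηP : η - 1 ∈ absMaximalIdeal F := by
    rw [hη1]
    exact Ideal.mul_mem_right _ _ h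
  -- `∑ η^i ≡ k+1 (mod 𝔓)`, hence `∑ η^i ∉ 𝔓`, in particular `≠ 0`
  have hsum : (∑ i ∈ range (k + 1), η ^ i) - (k + 1 : ℕ) ∈ absMaximalIdeal F := by
    have h4 : ∑ i ∈ range (k + 1), (η ^ i - 1) ∈ absMaximalIdeal F := by
      refine Ideal.sum_mem _ fun i _ => ?_
      obtain ⟨c, hc⟩ := sub_dvd_pow_sub_pow η 1 i
      rw [one_pow] at hc
      rw [hc]
      exact Ideal.mul_mem_right _ _ hηP
    rwa [sum_sub_distrib, sum_const, card_range, nsmul_eq_mul, mul_one] at h4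
  have hne : (∑ i ∈ range (k + 1), η ^ i) ≠ 0 := by
    intro h0
    rw [h0, zero_sub, Ideal.neg_mem_iff] at hsum
    exact natCast_notMem_absMaximalIdeal F hm hsum
  -- `(∑ η^i) (η - 1) = η^(k+1) - 1 = 0` in the domain `S`
  have hprod : (∑ i ∈ range (k + 1), η ^ i) * (η - 1) = 0 := by
    rw [geom_sum_mul, hηm, sub_self]
  have hη0 : η - 1 = 0 := (mul_eq_zero.mp hprod).resolve_left hne
  -- so `ζ₁ ζ₂^k = 1`, i.e. `ζ₁ = ζ₂`
  rw [sub_eq_zero, hη] at hη0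
  calc ζ₁ = ζ₁ * ζ₂ ^ k * ζ₂ := by rw [mul_assoc, ← pow_succ, h₂, mul_one]
    _ = ζ₂ := by rw [hη0, one_mul]

/-- The absolute inertia group fixes the roots of unity of order prime to `p` (they are distinct
modulo `𝔓`, and `σ ζ ≡ ζ` for `σ ∈ I_F`).
Ref: Serre, *Local Fields* (1979), Ch. IV §4 (the `(q-1)`-th roots of unity are in `K_nr`).
[folklore] -/
theorem smul_eq_self_of_mem_absInertia_of_pow_eq_one {m : ℕ} (hm : ¬ ringChar 𝓀[F] ∣ m)
    (hm0 : m ≠ 0) {σ : absoluteGaloisGroup F} (hσ : σ ∈ absInertia F)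
    {ζ : AlgebraicClosure F} (hζ : ζ ^ m = 1) : σ • ζ = ζ := by
  have hζint : IsIntegral 𝒪[F] ζ := by
    refine ⟨X ^ m - 1, monic_X_pow_sub_C (1 : 𝒪[F]) hm0, ?_⟩
    simp [hζ]
  set z : absIntegers 𝒪[F] F := ⟨ζ, hζint⟩ with hz
  have hzm : z ^ m = 1 := Subtype.ext (by simpa [hz] using hζ)
  have hσz : (σ • z) ^ m = 1 := by rw [← smul_pow', hzm, smul_one]
  have h := eq_of_pow_eq_one_of_sub_mem_absMaximalIdeal F hm hm0 hσz hzm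
    (mem_absInertia_iff.mp hσ z)
  exact congrArg Subtype.val h

omit [ValuativeRel F] [TopologicalSpace F] [IsNonarchimedeanLocalField F] in
/-- An element fixing `ζ` fixes the field `F(ζ)` pointwise. [folklore] -/
theorem smul_eq_self_of_mem_adjoin_simple {σ : absoluteGaloisGroup F} {ζ : AlgebraicClosure F}
    (hσ : σ • ζ = ζ) {x : AlgebraicClosure F} (hx : x ∈ IntermediateField.adjoin F {ζ}) :
    σ • x = x := by
  induction hx using IntermediateField.adjoin_induction with
  | mem x hx => rw [Set.mem_singleton_iff.mp hx]; exact hσ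
  | algebraMap x => exact smul_algebraMap σ x
  | add x y _ _ hx hy => rw [smul_add, hx, hy]
  | mul x y _ _ hx hy => rw [smul_mul', hx, hy]
  | inv x _ hx => rw [smul_inv'', hx]

/-- **`F(ζ)` is a finite abelian unramified extension** for a root of unity `ζ` of order prime to
`p`: finite abelian as a cyclotomic extension (Mathlib `IsCyclotomicExtension.isAbelianGalois`),
and fixed pointwise by the inertia group `I_F` (`smul_eq_self_of_mem_absInertia_of_pow_eq_one`).
Ref: Serre, *Local Fields* (1979), Ch. IV §4, Prop. 16 and Cor.; Ch. III §5 (unramified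
extensions). [folklore] -/
theorem adjoin_rootOfUnity_finite_abelian_unramified {m : ℕ} (hm : ¬ ringChar 𝓀[F] ∣ m)
    (hm0 : m ≠ 0) {ζ : AlgebraicClosure F} (hζ : ζ ^ m = 1) :
    FiniteDimensional F (IntermediateField.adjoin F {ζ}) ∧
      IsAbelianGalois F (IntermediateField.adjoin F {ζ}) ∧
      ∀ σ ∈ absInertia F, ∀ x : IntermediateField.adjoin F {ζ},
        σ • (x : AlgebraicClosure F) = x := by
  have hfin : FiniteDimensional F (IntermediateField.adjoin F {ζ}) :=
    IntermediateField.adjoin.finiteDimensional (Algebra.IsIntegral.isIntegral ζ)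
  -- `ζ` is a primitive `k`-th root of unity, `k = orderOf ζ ∣ m`
  have hfinord : IsOfFinOrder ζ := isOfFinOrder_iff_pow_eq_one.mpr ⟨m, Nat.pos_of_ne_zero hm0, hζ⟩
  haveI : NeZero (orderOf ζ) := ⟨(IsOfFinOrder.orderOf_pos hfinord).ne'⟩
  have hprim : IsPrimitiveRoot ζ (orderOf ζ) := IsPrimitiveRoot.orderOf ζ
  haveI := hprim.intermediateField_adjoin_isCyclotomicExtension (K := F)
  refine ⟨hfin, IsCyclotomicExtension.isAbelianGalois {orderOf ζ} F _, fun σ hσ x => ?_⟩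
  exact smul_eq_self_of_mem_adjoin_simple F
    (smul_eq_self_of_mem_absInertia_of_pow_eq_one F hm hm0 hσ hζ) x.2

/-- **Residues are Teichmüller**: every absolute integer `s` is `≡ 0` or `≡ ζ (mod 𝔓)` for a
root of unity `ζ ∈ S` of order prime to `p`.  (`s̄` lies in a finite subfield of `S ⧸ 𝔓`:
`s̄ ^ Q = s̄` for `Q = q ^ (d!)`, `d = [Γ_F : Gal(F̄/F(s))]`, by
`mk_pow_residueFieldCard_pow_factorial_index`; the `Q - 1` roots of unity of order `Q - 1` in
`F̄` have distinct residues, which therefore exhaust the roots of `X ^ (Q-1) - 1` in `S ⧸ 𝔓`.)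
Ref: Serre, *Local Fields* (1979), Ch. II §4, Prop. 8 (multiplicative representatives); Ch. IV
§4. [folklore] -/
theorem mem_or_exists_rootOfUnity_sub_mem (s : absIntegers 𝒪[F] F) :
    s ∈ absMaximalIdeal F ∨ ∃ (m : ℕ) (ζ : absIntegers 𝒪[F] F), ¬ ringChar 𝓀[F] ∣ m ∧ m ≠ 0 ∧
      ζ ^ m = 1 ∧ s - ζ ∈ absMaximalIdeal F := by
  classical
  by_cases hs : s ∈ absMaximalIdeal F
  · exact Or.inl hs
  right
  -- `s̄ ^ Q = s̄` with `Q = q ^ (d !)`, `d` the index of the (open) subgroup fixing `F(s)`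
  haveI : CompactSpace (absoluteGaloisGroup F) := absoluteGaloisGroup_compactSpace F
  let Ls : IntermediateField F (AlgebraicClosure F) :=
    IntermediateField.adjoin F {(s : AlgebraicClosure F)}
  haveI : FiniteDimensional F Ls :=
    IntermediateField.adjoin.finiteDimensional (Algebra.IsIntegral.isIntegral _)
  let N : Subgroup (absoluteGaloisGroup F) := Ls.fixingSubgroup
  haveI : Finite (absoluteGaloisGroup F ⧸ N) :=
    Subgroup.quotient_finite_of_isOpen N (IntermediateField.fixingSubgroup_isOpen Ls)
  haveI : N.FiniteIndex := Subgroup.finiteIndex_of_finite_quotient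
  have hN : ∀ τ ∈ N, τ • s = s := fun τ hτ => Subtype.ext (by
    rw [integralClosure.coe_smul]
    exact (IntermediateField.mem_fixingSubgroup_iff _ _).mp hτ _
      (IntermediateField.mem_adjoin_simple_self F (s : AlgebraicClosure F)))
  have hQ := mk_pow_residueFieldCard_pow_factorial_index F N s hN
  set Q := residueFieldCard F ^ N.index.factorial with hQdef
  -- the field `κ = S ⧸ 𝔓`; `s̄ ≠ 0`, so `s̄ ^ (Q - 1) = 1`
  haveI h𝔓 : (absMaximalIdeal F).IsMaximal := absMaximalIdeal_isMaximal_holds F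
  letI := Ideal.Quotient.field (absMaximalIdeal F)
  have hs0 : Ideal.Quotient.mk (absMaximalIdeal F) s ≠ 0 := by
    rwa [Ne, Ideal.Quotient.eq_zero_iff_mem]
  have hq1 : 1 < residueFieldCard F := one_lt_residueFieldCard F
  have hQ1 : 1 < Q := Nat.one_lt_pow (Nat.factorial_pos _).ne' hq1
  have hsQ : Ideal.Quotient.mk (absMaximalIdeal F) s ^ (Q - 1) = 1 := by
    have h : Ideal.Quotient.mk (absMaximalIdeal F) s ^ (Q - 1) *
        Ideal.Quotient.mk (absMaximalIdeal F) s = 1 * Ideal.Quotient.mk (absMaximalIdeal F) s := by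
      rw [← pow_succ, Nat.sub_add_cancel hQ1.le, hQ, one_mul]
    exact mul_right_cancel₀ hs0 h
  -- `p ∤ Q - 1`
  obtain ⟨f, hf0, hqp⟩ := residueFieldCard_eq_pow_ringChar F
  have hp : (ringChar 𝓀[F]).Prime := by
    letI := Fintype.ofFinite 𝓀[F]
    obtain ⟨n, hp, -⟩ := FiniteField.card 𝓀[F] (ringChar 𝓀[F])
    exact hp
  have hndvd : ¬ ringChar 𝓀[F] ∣ Q - 1 := by
    intro hdvd
    have hdvdQ : ringChar 𝓀[F] ∣ Q := by
      rw [hQdef, hqp, ← pow_mul]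
      exact dvd_pow_self _ (Nat.mul_ne_zero hf0.ne' (Nat.factorial_pos _).ne')
    have h1 : ringChar 𝓀[F] ∣ Q - (Q - 1) := Nat.dvd_sub hdvdQ hdvd
    rw [Nat.sub_sub_self hQ1.le, Nat.dvd_one] at h1
    exact hp.one_lt.ne' h1
  -- a primitive `(Q-1)`-th root of unity `ζ₀ ∈ S`
  haveI : NeZero ((Q - 1 : ℕ) : F) := ⟨natCast_ne_zero_of_not_dvd F hndvd⟩
  obtain ⟨ζ₀, hζ₀⟩ := HasEnoughRootsOfUnity.exists_primitiveRoot (AlgebraicClosure F) (Q - 1)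
  have hQ10 : Q - 1 ≠ 0 := by omega
  have hζ₀int : IsIntegral 𝒪[F] ζ₀ := by
    refine ⟨Polynomial.X ^ (Q - 1) - 1, Polynomial.monic_X_pow_sub_C (1 : 𝒪[F]) hQ10, ?_⟩
    simp [hζ₀.pow_eq_one]
  set z₀ : absIntegers 𝒪[F] F := ⟨ζ₀, hζ₀int⟩ with hz₀def
  have hz₀ : z₀ ^ (Q - 1) = 1 := Subtype.ext (by simpa [hz₀def] using hζ₀.pow_eq_one)
  -- the residues of `z₀ ^ i`, `i < Q - 1`, are distinct roots of `X ^ (Q-1) - 1`, hence all of them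
  let T : Finset (absIntegers 𝒪[F] F ⧸ absMaximalIdeal F) :=
    (Polynomial.nthRoots (Q - 1) (1 : absIntegers 𝒪[F] F ⧸ absMaximalIdeal F)).toFinset
  have hTcard : T.card ≤ (Finset.range (Q - 1)).card := by
    rw [Finset.card_range]
    exact (Multiset.toFinset_card_le _).trans (Polynomial.card_nthRoots _ _)
  have hmem : ∀ i ∈ Finset.range (Q - 1),
      Ideal.Quotient.mk (absMaximalIdeal F) (z₀ ^ i) ∈ T := fun i _ => by
    rw [Multiset.mem_toFinset, Polynomial.mem_nthRoots (by omega), ← map_pow, ← pow_mul,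
      mul_comm, pow_mul, hz₀, one_pow, map_one]
  have hinj : ∀ i₁ i₂ (h₁ : i₁ ∈ Finset.range (Q - 1)) (h₂ : i₂ ∈ Finset.range (Q - 1)),
      Ideal.Quotient.mk (absMaximalIdeal F) (z₀ ^ i₁) = Ideal.Quotient.mk _ (z₀ ^ i₂) →
        i₁ = i₂ := by
    intro i₁ i₂ h₁ h₂ h
    rw [Ideal.Quotient.eq] at h
    have h' := eq_of_pow_eq_one_of_sub_mem_absMaximalIdeal F hndvd hQ10
      (by rw [← pow_mul, mul_comm, pow_mul, hz₀, one_pow])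
      (by rw [← pow_mul, mul_comm, pow_mul, hz₀, one_pow]) h
    have h'' : ζ₀ ^ i₁ = ζ₀ ^ i₂ := by simpa [hz₀def] using congrArg Subtype.val h'
    exact hζ₀.pow_inj (Finset.mem_range.mp h₁) (Finset.mem_range.mp h₂) h''
  have hsT : Ideal.Quotient.mk (absMaximalIdeal F) s ∈ T := by
    rw [Multiset.mem_toFinset, Polynomial.mem_nthRoots (by omega)]
    exact hsQ
  obtain ⟨i, hi, hsi⟩ := Finset.surj_on_of_inj_on_of_card_le
    (fun i _ => Ideal.Quotient.mk (absMaximalIdeal F) (z₀ ^ i)) hmem hinj hTcard _ hsT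
  refine ⟨Q - 1, z₀ ^ i, hndvd, hQ10, by rw [← pow_mul, mul_comm, pow_mul, hz₀, one_pow], ?_⟩
  rw [← Ideal.Quotient.eq]
  exact hsi

/-- **An automorphism fixing all roots of unity of order prime to `p` lies in the inertia
group** `I_F` (the residue field of `F̄` is generated by their residues,
`mem_or_exists_rootOfUnity_sub_mem`).  Equivalently `F_nr = ⋃ F(ζ)`.
Ref: Serre, *Local Fields* (1979), Ch. IV §4, Cor. to Prop. 16 / Ch. III §5. [folklore] -/
theorem mem_absInertia_of_forall_rootOfUnity (δ : absoluteGaloisGroup F)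
    (hδ : ∀ (m : ℕ) (ζ : AlgebraicClosure F), ¬ ringChar 𝓀[F] ∣ m → m ≠ 0 → ζ ^ m = 1 →
      δ • ζ = ζ) : δ ∈ absInertia F := by
  rw [mem_absInertia_iff]
  intro s
  have hsmul : ∀ x : absIntegers 𝒪[F] F, x ∈ absMaximalIdeal F → δ • x ∈ absMaximalIdeal F :=
    fun x hx => by
      have h := Ideal.smul_mem_pointwise_smul δ x _ hx
      rwa [smul_absMaximalIdeal_holds F δ] at h
  rcases mem_or_exists_rootOfUnity_sub_mem F s with hs | ⟨m, ζ, hm, hm0, hζ, hsζ⟩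
  · exact sub_mem (hsmul s hs) hs
  · have hδζ : δ • ζ = ζ := Subtype.ext (by
      rw [integralClosure.coe_smul]
      exact hδ m ζ hm hm0 (by simpa using congrArg Subtype.val hζ))
    have h1 : δ • s - s = (δ • (s - ζ) - (s - ζ)) := by rw [smul_sub, hδζ]; ring
    rw [h1]
    exact sub_mem (hsmul _ hsζ) hsζ

end RootsOfUnity

namespace IsReciprocitySystem

variable {F E : Type*} [Field F] [ValuativeRel F] [TopologicalSpace F]
  [IsNonarchimedeanLocalField F] [Field E] [ValuativeRel E] [TopologicalSpace E]
  [IsNonarchimedeanLocalField E] [Algebra F E]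
variable {ωF : (L : IntermediateField F (AlgebraicClosure F)) → Fˣ →* (L ≃ₐ[F] L)}
  {ωE : (L' : IntermediateField E (AlgebraicClosure E)) → Eˣ →* (L' ≃ₐ[E] L')}

section OneField

variable {F : Type*} [Field F] [ValuativeRel F] [TopologicalSpace F] [IsNonarchimedeanLocalField F]
variable {ω : (L : IntermediateField F (AlgebraicClosure F)) → Fˣ →* (L ≃ₐ[F] L)}

/-! #### Uniformisers: representatives are Frobenius elements (Serre XIII §4 Prop. 13) -/

/-- A representative of `θ ϖ`, `ϖ` a uniformiser, differs from any arithmetic Frobenius `φ` by an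
element of `I_F`: both restrict to `ω_L ϖ = φ|_L` on every `L = F(ζ)`, `ζ` a root of unity of
order prime to `p` (`unramified_uniformizer`), so `γ φ⁻¹` fixes all such `ζ`
(`mem_absInertia_of_forall_rootOfUnity`).
Ref: Serre, *Local Fields* (1979), Ch. XIII §4, Prop. 13. [folklore] -/
theorem mul_inv_mem_absInertia_of_mem_reps (hω : IsReciprocitySystem F ω) {ϖ : Fˣ}
    (hϖ : (valuation F).IsUniformizer (ϖ : F)) {γ : absoluteGaloisGroup F} (hγ : γ ∈ hω.Reps ϖ)
    {φ : absoluteGaloisGroup F} (hφ : IsAbsArithFrob φ) : γ * φ⁻¹ ∈ absInertia F := by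
  apply mem_absInertia_of_forall_rootOfUnity
  intro m ζ hm hm0 hζ
  obtain ⟨hfin, hab, hI⟩ := adjoin_rootOfUnity_finite_abelian_unramified F hm hm0 hζ
  haveI := hfin
  haveI := hab
  have h1 := hγ (IntermediateField.adjoin F {ζ})
  have h2 := hω.unramified_uniformizer (IntermediateField.adjoin F {ζ}) hI ϖ hϖ φ hφ
  have h3 : AlgEquiv.restrictNormalHom (IntermediateField.adjoin F {ζ})
      (absoluteGaloisGroup.toAlgEquiv F (γ * φ⁻¹)) = 1 := by
    rw [map_mul, map_mul, map_inv, map_inv, h1, h2, mul_inv_cancel]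
  have h4 := AlgEquiv.congr_fun h3 ⟨ζ, IntermediateField.mem_adjoin_simple_self F ζ⟩
  rw [AlgEquiv.one_apply] at h4
  have h5 := congrArg Subtype.val h4
  rw [AlgEquiv.restrictNormalHom_apply] at h5
  exact h5

/-- Representatives of `θ ϖ` (`ϖ` a uniformiser) are arithmetic Frobenius elements of `Γ_F` in
the sense of `IsFrobPow σ 1` (they are `i φ`, `i ∈ I_F`, `φ` an arithmetic Frobenius, which
exists: `exists_isAbsArithFrob_holds`).
Ref: Serre, *Local Fields* (1979), Ch. XIII §4, Prop. 13. [folklore] -/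
theorem isFrobPow_one_of_mem_reps (hω : IsReciprocitySystem F ω) {ϖ : Fˣ}
    (hϖ : (valuation F).IsUniformizer (ϖ : F)) {σ : absoluteGaloisGroup F} (hσ : σ ∈ hω.Reps ϖ) :
    IsFrobPow σ 1 := by
  obtain ⟨φ, hφ⟩ := exists_isAbsArithFrob_holds F
  have hi := hω.mul_inv_mem_absInertia_of_mem_reps hϖ hσ hφ
  have h := IsFrobPow.inertia_mul_holds hi (IsAbsArithFrob.isFrobPow_holds hφ)
  rwa [inv_mul_cancel_right] at h

/-! #### Units: `θ(U_F)` is the image of `I_F` (Serre XIII §4 Cor. to Prop. 13, XIV §6 Cor. 2) -/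

/-- `θ u ∈ [I_F]` for a unit `u`: some `i ∈ I_F` represents `θ u` — the closed conditions
`i ∈ I_F`, `i|_L = ω_L u` have the finite intersection property by `map_unitGroup` on the
compositum and `compatible`, and `Γ_F` is compact.
Ref: Serre, *Local Fields* (1979), Ch. XIII §4, Cor. to Prop. 13. [folklore] -/
theorem exists_mem_absInertia_mem_reps (hω : IsReciprocitySystem F ω) {u : Fˣ}
    (hu : u ∈ (valuation F).valuationSubring.unitGroup) : ∃ i ∈ absInertia F, i ∈ hω.Reps u := by
  classical
  haveI : CompactSpace (absoluteGaloisGroup F) := absoluteGaloisGroup_compactSpace F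
  let ι := {L : IntermediateField F (AlgebraicClosure F) //
    FiniteDimensional F L ∧ IsAbelianGalois F L}
  let Z : ι → Set (absoluteGaloisGroup F) := fun i =>
    haveI := i.2.1; haveI := i.2.2
    {γ | AlgEquiv.restrictNormalHom i.1 (absoluteGaloisGroup.toAlgEquiv F γ) = ω i.1 u}
  have hZ : ∀ i, IsClosed (Z i) := fun i => by
    haveI := i.2.1; haveI := i.2.2
    exact isClosed_setOf_restrictNormalHom_eq i.1 (ω i.1 u)
  suffices h : ((absInertia F : Set (absoluteGaloisGroup F)) ∩ ⋂ i, Z i).Nonempty by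
    obtain ⟨γ, hγI, hγ⟩ := h
    exact ⟨γ, hγI, fun L hL hL' => Set.mem_iInter.mp hγ ⟨L, hL, hL'⟩⟩
  by_contra hempty
  rw [Set.not_nonempty_iff_eq_empty] at hempty
  obtain ⟨t, ht⟩ := (isClosed_absInertia_holds F).isCompact.elim_finite_subfamily_closed Z hZ
    hempty
  let M : IntermediateField F (AlgebraicClosure F) := t.sup fun i => i.1
  have hM : FiniteDimensional F M ∧ IsAbelianGalois F M := by
    refine Finset.sup_induction (p := fun N : IntermediateField F (AlgebraicClosure F) =>
      FiniteDimensional F N ∧ IsAbelianGalois F N) ⟨inferInstance, inferInstance⟩ ?_ ?_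
    · rintro N₁ ⟨h₁, h₁'⟩ N₂ ⟨h₂, h₂'⟩
      haveI := h₁; haveI := h₁'; haveI := h₂; haveI := h₂'
      exact ⟨inferInstance, isAbelianGalois_sup N₁ N₂⟩
    · intro i _
      exact i.2
  haveI := hM.1
  haveI := hM.2
  -- `ω_M u` is the restriction of some `i ∈ I_F` (units ↦ inertia at level `M`)
  have hmem : ω M u ∈ ((valuation F).valuationSubring.unitGroup).map (ω M) := ⟨u, hu, rfl⟩
  rw [hω.map_unitGroup M] at hmem
  obtain ⟨i, hiI, hi⟩ := hmem
  have hγ : i ∈ (absInertia F : Set (absoluteGaloisGroup F)) ∩ ⋂ j ∈ t, Z j := by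
    refine ⟨hiI, Set.mem_iInter₂.mpr fun j hj => ?_⟩
    haveI := j.2.1; haveI := j.2.2
    exact hω.compatible j.1 M (Finset.le_sup (f := fun j : ι => j.1) hj) u i hi
  rw [ht] at hγ
  exact hγ

variable (hω : IsReciprocitySystem F ω)

/-- `θ(U_F) ≤ [I_F]`.  Ref: Serre, *Local Fields* (1979), Ch. XIII §4, Cor. to Prop. 13.
[folklore] -/
theorem map_unitGroup_theta_le :
    ((valuation F).valuationSubring.unitGroup).map hω.theta ≤
      (absInertia F).map (absGaloisAbProj F) := by
  rintro _ ⟨u, hu, rfl⟩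
  obtain ⟨i, hiI, hi⟩ := hω.exists_mem_absInertia_mem_reps hu
  exact ⟨i, hiI, hω.absGaloisAbProj_eq_theta_iff.mpr hi⟩

/-- `[I_F] ≤ θ(U_F)`, given that norm groups are closed (Serre XIV §6, axiom III-1): for
`i ∈ I_F` the closed conditions `ω_L u = i|_L` on the compact `U_F` have the finite intersection
property by `map_unitGroup` on the compositum and `compatible`.
Ref: Serre, *Local Fields* (1979), Ch. XIII §4, Cor. to Prop. 13; Ch. XIV §6, Cor. 2 (ii).
[folklore] -/
theorem le_map_unitGroup_theta (hclosed : isClosed_of_isNormSubgroup F) :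
    (absInertia F).map (absGaloisAbProj F) ≤
      ((valuation F).valuationSubring.unitGroup).map hω.theta := by
  classical
  rintro _ ⟨i, hiI, rfl⟩
  -- it suffices to find a unit `u` with `i ∈ Reps u`
  suffices h : ∃ u ∈ (valuation F).valuationSubring.unitGroup, i ∈ hω.Reps u by
    obtain ⟨u, hu, hi⟩ := h
    exact ⟨u, hu, (hω.absGaloisAbProj_eq_theta_iff.mpr hi).symm⟩
  let ι := {L : IntermediateField F (AlgebraicClosure F) //
    FiniteDimensional F L ∧ IsAbelianGalois F L}
  let Z : ι → Set Fˣ := fun j =>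
    haveI := j.2.1; haveI := j.2.2
    {u | ω j.1 u = AlgEquiv.restrictNormalHom j.1 (absoluteGaloisGroup.toAlgEquiv F i)}
  -- each condition is closed: empty or a coset of the closed norm group `N_L = ker ω_L`
  have hZ : ∀ j, IsClosed (Z j) := fun j => by
    haveI := j.2.1; haveI := j.2.2
    rcases (Z j).eq_empty_or_nonempty with h0 | ⟨u₀, hu₀⟩
    · rw [h0]
      exact isClosed_empty
    · have hker : IsClosed ((ω j.1).ker : Set Fˣ) := by
        rw [hω.ker_eq j.1]
        exact hclosed _ (isNormSubgroup_range F j.1)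
      have heq : Z j = (fun u => u₀ * u) '' ((ω j.1).ker : Set Fˣ) := by
        ext u
        constructor
        · intro hu
          refine ⟨u₀⁻¹ * u, ?_, by simp⟩
          rw [SetLike.mem_coe, MonoidHom.mem_ker, map_mul, map_inv, show ω j.1 u = _ from hu,
            show ω j.1 u₀ = _ from hu₀, inv_mul_cancel]
        · rintro ⟨k, hk, rfl⟩
          change ω j.1 (u₀ * k) = _
          rw [map_mul, show ω j.1 u₀ = _ from hu₀, (MonoidHom.mem_ker.mp hk), mul_one]
      rw [heq]
      exact (Homeomorph.mulLeft u₀).isClosedMap _ hker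
  suffices h : ((((valuation F).valuationSubring.unitGroup : Subgroup Fˣ) : Set Fˣ) ∩
      ⋂ j, Z j).Nonempty by
    obtain ⟨u, hu, huZ⟩ := h
    exact ⟨u, hu, fun L hL hL' => (Set.mem_iInter.mp huZ ⟨L, hL, hL'⟩).symm⟩
  by_contra hempty
  rw [Set.not_nonempty_iff_eq_empty] at hempty
  obtain ⟨t, ht⟩ := (isCompact_unitGroup F).elim_finite_subfamily_closed Z hZ hempty
  let M : IntermediateField F (AlgebraicClosure F) := t.sup fun j => j.1
  have hM : FiniteDimensional F M ∧ IsAbelianGalois F M := by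
    refine Finset.sup_induction (p := fun N : IntermediateField F (AlgebraicClosure F) =>
      FiniteDimensional F N ∧ IsAbelianGalois F N) ⟨inferInstance, inferInstance⟩ ?_ ?_
    · rintro N₁ ⟨h₁, h₁'⟩ N₂ ⟨h₂, h₂'⟩
      haveI := h₁; haveI := h₁'; haveI := h₂; haveI := h₂'
      exact ⟨inferInstance, isAbelianGalois_sup N₁ N₂⟩
    · intro j _
      exact j.2
  haveI := hM.1
  haveI := hM.2
  -- at level `M`, `i|_M = ω_M u` for some unit `u`
  have hmem : AlgEquiv.restrictNormalHom M (absoluteGaloisGroup.toAlgEquiv F i) ∈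
      (absInertia F).map ((AlgEquiv.restrictNormalHom M).comp
        (absoluteGaloisGroup.toAlgEquiv F).toMonoidHom) := ⟨i, hiI, rfl⟩
  rw [← hω.map_unitGroup M] at hmem
  obtain ⟨u, hu, hui⟩ := hmem
  have hγ : u ∈ (((valuation F).valuationSubring.unitGroup : Subgroup Fˣ) : Set Fˣ) ∩
      ⋂ j ∈ t, Z j := by
    refine ⟨hu, Set.mem_iInter₂.mpr fun j hj => ?_⟩
    haveI := j.2.1; haveI := j.2.2
    exact (hω.compatible j.1 M (Finset.le_sup (f := fun j : ι => j.1) hj) u i hui.symm).symm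
  rw [ht] at hγ
  exact hγ

/-- **`θ(U_F) = [I_F]`** (the image of the absolute inertia group in `Γ_F^ab`).
Ref: Serre, *Local Fields* (1979), Ch. XIII §4, Cor. to Prop. 13; Ch. XIV §6, Cor. 2 (ii).
[folklore] -/
theorem map_unitGroup_theta (hclosed : isClosed_of_isNormSubgroup F) :
    ((valuation F).valuationSubring.unitGroup).map hω.theta =
      (absInertia F).map (absGaloisAbProj F) :=
  le_antisymm hω.map_unitGroup_theta_le (hω.le_map_unitGroup_theta hclosed)

/-! #### Injectivity (Serre XIV §6 Cor. 2 (i)) -/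

/-- The kernel of `θ` is the group of universal norms `⋂_L N_L`.
Ref: Serre, *Local Fields* (1979), Ch. XIII §4 (`(x, L/F) = 1 ⟺ x ∈ N Lˣ`). [folklore] -/
theorem mem_ker_theta_iff (x : Fˣ) : hω.theta x = 1 ↔ x ∈ universalNormSubgroup F := by
  rw [mem_universalNormSubgroup_iff, ← map_one (absGaloisAbProj F), eq_comm,
    hω.absGaloisAbProj_eq_theta_iff]
  constructor
  · rintro h U ⟨L, hL, hL', rfl⟩
    haveI := hL; haveI := hL'
    rw [← hω.ker_eq L, MonoidHom.mem_ker, ← h L, map_one, map_one]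
  · intro h L _ _
    have hx := h _ (isNormSubgroup_range F L)
    rw [← hω.ker_eq L, MonoidHom.mem_ker] at hx
    rw [map_one, map_one, hx]

/-- **`θ` is injective** when the universal norm group is trivial (Serre XIV §6 Cor. 2 (i):
the intersection of the norm groups is `{1}`).
Ref: Serre, *Local Fields* (1979), Ch. XIV §6, Cor. 2 (i). [folklore] -/
theorem theta_injective (huniv : universalNormSubgroup F = ⊥) : Function.Injective hω.theta := by
  rw [injective_iff_map_eq_one]
  intro x hx
  have h := (hω.mem_ker_theta_iff x).mp hx
  rwa [huniv, Subgroup.mem_bot] at h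

/-! #### Continuity (norm groups are open) and the embedding of `U_F` -/

omit [ValuativeRel F] [TopologicalSpace F] [IsNonarchimedeanLocalField F] in
/-- The norm groups `N_L = ker ω_L` have finite index (`ω_L` maps into the finite `G(L/F)`).
[folklore] -/
theorem finiteIndex_ker (L : IntermediateField F (AlgebraicClosure F)) [FiniteDimensional F L]
    [IsAbelianGalois F L] : (ω L).ker.FiniteIndex := by
  refine ⟨fun h => ?_⟩
  rw [Subgroup.index_ker] at h
  exact (Nat.card_pos (α := (ω L).range)).ne' h

/-- **`θ` is continuous**, given that norm groups are closed (hence open, having finite index):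
a neighbourhood of `1` in `Γ_F^ab` pulls back to one containing an open normal `V ≤ Γ_F`;
`closure [Γ_F, Γ_F] · V = Gal(F̄/L)` for a finite abelian `L`
(`absoluteGaloisGroup.exists_isAbelianGalois_fixingSubgroup_eq`), and `θ (N_L)` lands in the
image of `V`.
Ref: Serre, *Local Fields* (1979), Ch. XIV §6, Cor. 1 (norm groups are open) and Cor. 2.
[folklore] -/
theorem continuous_theta (hclosed : isClosed_of_isNormSubgroup F) : Continuous hω.theta := by
  classical
  haveI : CompactSpace (absoluteGaloisGroup F) := absoluteGaloisGroup_compactSpace F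
  refine continuous_of_continuousAt_one hω.theta (continuousAt_def.mpr fun O hO => ?_)
  rw [map_one] at hO
  -- an open normal `V ≤ Γ_F` mapping into `O`
  have hO' : (absGaloisAbProj F) ⁻¹' O ∈ nhds (1 : absoluteGaloisGroup F) :=
    QuotientGroup.continuous_mk.continuousAt.preimage_mem_nhds (by simpa using hO)
  obtain ⟨V, hV⟩ := ProfiniteGrp.exist_openNormalSubgroup_sub_open_nhds_of_one isOpen_interior
    (mem_interior_iff_mem_nhds.mpr hO')
  have hVO : (V : Set (absoluteGaloisGroup F)) ⊆ (absGaloisAbProj F) ⁻¹' O :=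
    hV.trans interior_subset
  -- `C V = Gal(F̄/L)` for a finite abelian `L`
  set C := (commutator (absoluteGaloisGroup F)).topologicalClosure with hCdef
  let U : Subgroup (absoluteGaloisGroup F) := C ⊔ V.toSubgroup
  haveI : V.toSubgroup.Normal := V.isNormal'
  haveI : U.Normal := Subgroup.sup_normal _ _
  have hUopen : IsOpen (U : Set (absoluteGaloisGroup F)) :=
    Subgroup.isOpen_mono le_sup_right V.isOpen
  have hcomm : ∀ a b : absoluteGaloisGroup F, a * b * a⁻¹ * b⁻¹ ∈ U := fun a b =>
    Subgroup.mem_sup_left (Subgroup.le_topologicalClosure _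
      (Subgroup.commutator_mem_commutator (Subgroup.mem_top a) (Subgroup.mem_top b)))
  obtain ⟨L, hLfin, hLab, hLfix⟩ :=
    absoluteGaloisGroup.exists_isAbelianGalois_fixingSubgroup_eq F U hUopen hcomm
  haveI := hLfin
  haveI := hLab
  -- `θ⁻¹ O ⊇ N_L`, an open subgroup
  have hNopen : IsOpen ((ω L).ker : Set Fˣ) := by
    haveI := finiteIndex_ker (ω := ω) L
    refine Subgroup.isOpen_of_isClosed_of_finiteIndex _ ?_
    rw [hω.ker_eq L]
    exact hclosed _ (isNormSubgroup_range F L)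
  refine Filter.mem_of_superset (hNopen.mem_nhds (one_mem _)) fun x hx => ?_
  rw [Set.mem_preimage]
  obtain ⟨γ, hγ⟩ := hω.reps_nonempty x
  have hγL : absoluteGaloisGroup.toAlgEquiv F γ ∈ L.fixingSubgroup := by
    rw [← IntermediateField.restrictNormalHom_ker L, MonoidHom.mem_ker, hγ L,
      MonoidHom.mem_ker.mp hx]
  rw [hLfix] at hγL
  have hγU : γ ∈ (U : Set (absoluteGaloisGroup F)) := hγL
  rw [Subgroup.mul_normal] at hγU
  obtain ⟨c, hc, v, hv, rfl⟩ := hγU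
  have hc1 : absGaloisAbProj F c = 1 := (QuotientGroup.eq_one_iff c).mpr hc
  rw [← hω.absGaloisAbProj_eq_theta_iff.mpr hγ, map_mul, hc1, one_mul]
  exact hVO hv

/-- **`θ` restricted to `U_F` is an embedding** (continuous and injective on the compact `U_F`
into the Hausdorff `Γ_F^ab`).
Ref: Serre, *Local Fields* (1979), Ch. XIV §6, Cor. 2 (ii). [folklore] -/
theorem isEmbedding_theta_unitGroup (huniv : universalNormSubgroup F = ⊥)
    (hclosed : isClosed_of_isNormSubgroup F) :
    Topology.IsEmbedding fun u : (valuation F).valuationSubring.unitGroup => hω.theta (u : Fˣ) := by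
  haveI : CompactSpace ((valuation F).valuationSubring.unitGroup : Subgroup Fˣ) :=
    isCompact_iff_compactSpace.mp (isCompact_unitGroup F)
  haveI : IsClosed ((commutator (absoluteGaloisGroup F)).topologicalClosure :
      Set (absoluteGaloisGroup F)) := Subgroup.isClosed_topologicalClosure _
  have hcont : Continuous fun u : (valuation F).valuationSubring.unitGroup => hω.theta (u : Fˣ) :=
    (hω.continuous_theta hclosed).comp continuous_subtype_val
  have hinj : Function.Injective fun u : (valuation F).valuationSubring.unitGroup =>
      hω.theta (u : Fˣ) :=
    fun u v h => Subtype.ext (hω.theta_injective huniv h)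
  exact (hcont.isClosedEmbedding hinj).isEmbedding

end OneField

section Range

variable {F : Type*} [Field F] [ValuativeRel F] [TopologicalSpace F] [IsNonarchimedeanLocalField F]
variable {ω : (L : IntermediateField F (AlgebraicClosure F)) → Fˣ →* (L ≃ₐ[F] L)}
variable (hω : IsReciprocitySystem F ω)

/-- **The image of `θ` is `[W_F]`**, the image of the Weil group in `Γ_F^ab`: `θ ϖ` is
represented by a Frobenius element and `θ(U_F) = [I_F]`; conversely an element of `W_F` of
degree `n` is `i φ^n` with `i ∈ I_F`.
Ref: Serre, *Local Fields* (1979), Ch. XIV §6, Remark 2 (`K* ≅ 𝔄_K^0`). [folklore] -/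
theorem range_theta_eq (hclosed : isClosed_of_isNormSubgroup F) :
    hω.theta.range = (weilSubgroup F).map (absGaloisAbProj F) := by
  obtain ⟨ϖ, hϖ⟩ : ∃ ϖ : Fˣ, (valuation F).IsUniformizer (ϖ : F) :=
    Literature.NumberTheory.GaloisRepresentations.exists_units_isUniformizer
  set γ := (hω.reps_nonempty ϖ).some with hγdef
  have hγ : γ ∈ hω.Reps ϖ := (hω.reps_nonempty ϖ).some_mem
  have hγθ : absGaloisAbProj F γ = hω.theta ϖ := hω.absGaloisAbProj_eq_theta_iff.mpr hγ
  have hγW : γ ∈ weilSubgroup F :=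
    mem_weilSubgroup_of_isFrobPow (hω.isFrobPow_one_of_mem_reps hϖ hγ)
  apply le_antisymm
  · rintro _ ⟨x, rfl⟩
    obtain ⟨u, n, hu, rfl⟩ := exists_unitGroup_mul_zpow hϖ x
    rw [map_mul, map_zpow, ← hγθ]
    have hγmem : absGaloisAbProj F γ ∈ (weilSubgroup F).map (absGaloisAbProj F) :=
      Subgroup.mem_map.mpr ⟨γ, hγW, rfl⟩
    have humem : hω.theta u ∈ ((valuation F).valuationSubring.unitGroup).map hω.theta :=
      Subgroup.mem_map.mpr ⟨u, hu, rfl⟩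
    obtain ⟨i, hi, hi'⟩ := hω.map_unitGroup_theta_le humem
    exact mul_mem (Subgroup.mem_map.mpr ⟨i, absInertia_le_weilSubgroup F hi, hi'⟩)
      (zpow_mem hγmem n)
  · rintro _ ⟨w, hw, rfl⟩
    obtain ⟨n, hn⟩ := (mem_weilSubgroup_iff IsFrobPow.mul_holds).mp hw
    have hγn : IsFrobPow (γ ^ n) n := by
      simpa using (hω.isFrobPow_one_of_mem_reps hϖ hγ).zpow n
    have hi : w * (γ ^ n)⁻¹ ∈ absInertia F := IsFrobPow.mul_inv_mem_absInertia_holds hn hγn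
    have hi' : absGaloisAbProj F (w * (γ ^ n)⁻¹) ∈
        ((valuation F).valuationSubring.unitGroup).map hω.theta := by
      rw [hω.map_unitGroup_theta hclosed]
      exact Subgroup.mem_map.mpr ⟨w * (γ ^ n)⁻¹, hi, rfl⟩
    obtain ⟨u, -, hu⟩ := hi'
    refine ⟨u * ϖ ^ n, ?_⟩
    rw [map_mul, map_zpow, hu, ← hγθ, ← map_zpow, ← map_mul, inv_mul_cancel_right]

/-- **The limit of a reciprocity system is a reciprocity map** with the printed properties
(`Literature.NumberTheory.GaloisRepresentations.IsLocalReciprocityMap`), given the two norm-group inputs of the existence theorem: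
the universal norm group is trivial (Serre XIV §6 Cor. 2 (i)) and norm groups are closed
(XIV §6, axiom III-1; the named fact `isClosed_of_isNormSubgroup` of `LocalExistenceTheorem`).
Ref: Serre, *Local Fields* (1979), Ch. XIII §4 (Prop. 13 and Cor.), Ch. XIV §6 (Cor. 2,
Remark 2). [folklore] -/
theorem isLocalReciprocityMap_theta (huniv : universalNormSubgroup F = ⊥)
    (hclosed : isClosed_of_isNormSubgroup F) : IsLocalReciprocityMap F hω.theta where
  injective := hω.theta_injective huniv
  range_eq := hω.range_theta_eq hclosed
  map_unitGroup := hω.map_unitGroup_theta hclosed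
  isEmbedding_unitGroup := hω.isEmbedding_theta_unitGroup huniv hclosed
  isFrobPow_one_of_isUniformizer _ hx _ hσ :=
    hω.isFrobPow_one_of_mem_reps hx (hω.absGaloisAbProj_eq_theta_iff.mp hσ)

end Range


/-- **Norm functoriality in the limit** (Cassels–Fröhlich VI §2.4, second diagram): if the pair
of systems satisfies the norm-compatibility clause of `exists_isReciprocitySystem_normCompatible`
(a representative `γ ∈ Γ_E` of `θ_E x` restricts to a representative of `θ_F (N_{E/F} x)`), then
the limit maps satisfy `θ_F ∘ N_{E/F} = i ∘ θ_E` (`Literature.NumberTheory.GaloisRepresentations.IsNormCompatible`).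
Ref: Serre in Cassels–Fröhlich (1967), Ch. VI §2.4; Serre, *Local Fields* (1979), Ch. XIII §4,
Prop. 10 (a). [folklore] -/
theorem isNormCompatible_theta (hF : IsReciprocitySystem F ωF) (hE : IsReciprocitySystem E ωE)
    (hN : ∀ x : Eˣ, ∃ γ : absoluteGaloisGroup E,
      (∀ (L' : IntermediateField E (AlgebraicClosure E)) [FiniteDimensional E L']
        [IsAbelianGalois E L'],
        AlgEquiv.restrictNormalHom L' (absoluteGaloisGroup.toAlgEquiv E γ) = ωE L' x) ∧
      ∀ (L : IntermediateField F (AlgebraicClosure F)) [FiniteDimensional F L]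
        [IsAbelianGalois F L],
        AlgEquiv.restrictNormalHom L (absoluteGaloisGroup.toAlgEquiv F (absGaloisRestrict F E γ)) =
          ωF L (Units.map (Algebra.norm F : E →* F) x)) :
    IsNormCompatible F E hF.theta hE.theta := by
  intro x
  obtain ⟨γ, hγE, hγF⟩ := hN x
  have h1 : absGaloisAbProj E γ = hE.theta x :=
    hE.absGaloisAbProj_eq_theta_iff.mpr fun L' _ _ => hγE L'
  have h2 : absGaloisAbProj F (absGaloisRestrict F E γ) =
      hF.theta (Units.map (Algebra.norm F : E →* F) x) :=
    hF.absGaloisAbProj_eq_theta_iff.mpr fun L _ _ => hγF L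
  rw [← h2, ← h1, absGaloisRestrictAb_mk]

end IsReciprocitySystem

/-! ### The universal norm group is trivial (Serre XIV §6 Cor. 2 (i)) -/

section UniversalNorm

variable (F : Type*) [Field F] [ValuativeRel F] [TopologicalSpace F] [IsNonarchimedeanLocalField F]

/-- A non-archimedean local field is totally disconnected (its topology comes from an
ultrametric absolute value).  Ref: Serre, *Local Fields* (1979), Ch. II §1. [folklore] -/
theorem totallyDisconnectedSpace_of_isNonarchimedeanLocalField : TotallyDisconnectedSpace F := by
  letI := IsTopologicalAddGroup.rightUniformSpace F
  haveI := isUniformAddGroup_of_addCommGroup (G := F)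
  letI : (Valued.v (R := F)).RankOne :=
    { hom' := IsRankLeOne.nonempty.some.emb (R := F) |>.comp
        MonoidWithZeroHom.ValueGroup₀.embedding
      strictMono' := IsRankLeOne.nonempty.some.strictMono.comp
        MonoidWithZeroHom.ValueGroup₀.embedding_strictMono }
  letI := Valued.toNormedField F (ValueGroupWithZero F)
  infer_instance

/-- `Fˣ` is totally disconnected (it embeds into `F`).  [folklore] -/
theorem totallyDisconnectedSpace_units : TotallyDisconnectedSpace Fˣ := by
  haveI := totallyDisconnectedSpace_of_isNonarchimedeanLocalField F
  refine ⟨?_⟩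
  have h := isTotallyDisconnected_of_image (s := (Set.univ : Set Fˣ))
    (Units.continuous_val (M := F)).continuousOn Units.val_injective
    (isTotallyDisconnected_of_totallyDisconnectedSpace _)
  exact h

/-- `ϖ ^ k` is a unit of `𝒪_F` only for `k = 0` (`v ϖ < 1`).
Ref: Serre, *Local Fields* (1979), Ch. II §1. [folklore] -/
theorem zpow_mem_unitGroup_iff {ϖ : Fˣ} (hϖ : (valuation F).IsUniformizer (ϖ : F)) (k : ℤ) :
    ϖ ^ k ∈ (valuation F).valuationSubring.unitGroup ↔ k = 0 := by
  rw [Valuation.mem_unitGroup_iff, Units.val_zpow_eq_zpow_val, map_zpow₀, hϖ.val]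
  constructor
  · intro h
    rcases lt_trichotomy k 0 with hk | rfl | hk
    · exfalso
      obtain ⟨n, hn⟩ := Int.exists_eq_neg_ofNat hk.le
      rw [hn, zpow_neg, zpow_natCast, inv_eq_one] at h
      have hn0 : n ≠ 0 := by rintro rfl; simp at hn; omega
      exact (pow_lt_one₀ zero_le (Valuation.IsRankOneDiscrete.generator_lt_one _) hn0).ne h
    · rfl
    · exfalso
      obtain ⟨n, rfl⟩ := Int.eq_ofNat_of_zero_le hk.le
      rw [zpow_natCast] at h
      have hn0 : n ≠ 0 := by rintro rfl; simp at hk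
      exact (pow_lt_one₀ zero_le (Valuation.IsRankOneDiscrete.generator_lt_one _) hn0).ne h
  · rintro rfl
    rw [zpow_zero]

/-- If `N` is an open subgroup of `U_F` of finite index and `n ≥ 1`, the subgroup
`N · ϖ^{nℤ}`-style over-group `V` (any subgroup containing `ϖ ^ n` modulo which `U_F` has
finitely many classes) has finite index in `Fˣ = U_F · ϖ^ℤ`. [folklore] -/
theorem finiteIndex_of_pow_mem {ϖ : Fˣ} (hϖ : (valuation F).IsUniformizer (ϖ : F))
    {V : Subgroup Fˣ} {n : ℕ} (hn : 0 < n) (hV : ϖ ^ n ∈ V)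
    (hfin : ((QuotientGroup.mk : Fˣ → Fˣ ⧸ V) ''
      ((valuation F).valuationSubring.unitGroup : Set Fˣ)).Finite) :
    V.FiniteIndex := by
  classical
  set S := (QuotientGroup.mk : Fˣ → Fˣ ⧸ V) '' ((valuation F).valuationSubring.unitGroup : Set Fˣ)
  have hcov : (Set.univ : Set (Fˣ ⧸ V)) ⊆
      ⋃ i : Fin n, (fun s => (QuotientGroup.mk (ϖ ^ (i : ℕ)) : Fˣ ⧸ V) * s) '' S := by
    rintro q -
    induction q using QuotientGroup.induction_on with
    | H y =>
      obtain ⟨u, k, hu, rfl⟩ := exists_unitGroup_mul_zpow hϖ y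
      have hn0 : (n : ℤ) ≠ 0 := by exact_mod_cast hn.ne'
      refine Set.mem_iUnion.mpr ⟨⟨(k % n).toNat, ?_⟩, ⟨QuotientGroup.mk u, ⟨u, hu, rfl⟩, ?_⟩⟩
      · have h1 : ((k % n).toNat : ℤ) < n := by
          rw [Int.toNat_of_nonneg (Int.emod_nonneg _ hn0)]
          exact Int.emod_lt_of_pos _ (by exact_mod_cast hn)
        exact_mod_cast h1
      · have hk : (((k % n).toNat : ℕ) : ℤ) = k - n * (k / n) := by
          rw [Int.toNat_of_nonneg (Int.emod_nonneg _ hn0), Int.emod_def]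
        show (QuotientGroup.mk (ϖ ^ (k % n).toNat) : Fˣ ⧸ V) * QuotientGroup.mk u =
          QuotientGroup.mk (u * ϖ ^ k)
        rw [← QuotientGroup.mk_mul, QuotientGroup.eq]
        have h2 : (ϖ ^ (k % ↑n).toNat * u)⁻¹ * (u * ϖ ^ k) = (ϖ ^ n) ^ (k / n) := by
          rw [show ϖ ^ (k % ↑n).toNat = ϖ ^ (((k % n).toNat : ℕ) : ℤ) from (zpow_natCast _ _).symm,
            hk, mul_comm _ u, mul_inv_rev, mul_assoc, inv_mul_cancel_left, ← zpow_neg, ← zpow_add,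
            ← zpow_natCast ϖ n, ← zpow_mul]
          congr 1
          ring
        rw [h2]
        exact V.zpow_mem hV _
  have hfinU : (Set.univ : Set (Fˣ ⧸ V)).Finite :=
    (Set.finite_iUnion fun i => hfin.image _).subset hcov
  haveI : Finite (Fˣ ⧸ V) := Set.finite_univ_iff.mp hfinU
  exact Subgroup.finiteIndex_of_finite_quotient

/-- **Open subgroups of finite index of `Fˣ` separate points**: `Fˣ = U_F · ϖ^ℤ` with `U_F`
open and profinite; `x = u ϖ^e ≠ 1` is excluded by `U_F · ϖ^{nℤ}` with `n ∤ e` if `e ≠ 0`, and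
by `N · ϖ^ℤ` with `N ≤ U_F` an open normal subgroup of finite index excluding `u` if `e = 0`.
Ref: Serre, *Local Fields* (1979), Ch. XIV §6, proof of Cor. 2 (`⋂ V_{n,m} = 1`). [folklore] -/
theorem exists_isOpen_finiteIndex_notMem {x : Fˣ} (hx : x ≠ 1) :
    ∃ U : Subgroup Fˣ, IsOpen (U : Set Fˣ) ∧ U.FiniteIndex ∧ x ∉ U := by
  classical
  obtain ⟨ϖ, hϖ⟩ : ∃ ϖ : Fˣ, (valuation F).IsUniformizer (ϖ : F) := exists_units_isUniformizer
  set UF := ((valuation F).valuationSubring.unitGroup : Subgroup Fˣ) with hUF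
  obtain ⟨u, e, hu, rfl⟩ := exists_unitGroup_mul_zpow hϖ x
  by_cases he : e = 0
  · -- `x = u ∈ U_F`, `u ≠ 1`: separate `u` from `1` in the profinite group `U_F`
    subst he
    rw [zpow_zero, mul_one] at hx ⊢
    haveI := totallyDisconnectedSpace_units F
    haveI : CompactSpace UF := isCompact_iff_compactSpace.mp (isCompact_unitGroup F)
    let u₀ : UF := ⟨u, hu⟩
    have hu₀ : u₀ ≠ 1 := fun h0 => hx (congrArg Subtype.val h0)
    obtain ⟨N, hN⟩ := ProfiniteGrp.exist_openNormalSubgroup_sub_open_nhds_of_one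
      (isOpen_compl_singleton (x := u₀)) (by simpa using hu₀.symm)
    haveI : Finite (UF ⧸ N.toSubgroup) := Subgroup.quotient_finite_of_isOpen _ N.isOpen
    set M : Subgroup Fˣ := N.toSubgroup.map UF.subtype with hM
    have hMU : M ≤ UF := Subgroup.map_subtype_le _
    refine ⟨M ⊔ Subgroup.zpowers ϖ, ?_, ?_, ?_⟩
    · refine Subgroup.isOpen_mono le_sup_left ?_
      rw [hM, Subgroup.coe_map, Subgroup.coe_subtype]
      exact (isOpen_unitGroup (F := F)).isOpenMap_subtype_val _ N.isOpen
    · refine finiteIndex_of_pow_mem F hϖ Nat.one_pos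
        (Subgroup.mem_sup_right (by rw [pow_one]; exact Subgroup.mem_zpowers ϖ)) ?_
      have hle : N.toSubgroup ≤
          ((QuotientGroup.mk' (M ⊔ Subgroup.zpowers ϖ)).comp UF.subtype).ker := by
        intro m hm
        rw [MonoidHom.mem_ker, MonoidHom.comp_apply, QuotientGroup.mk'_apply,
          QuotientGroup.eq_one_iff]
        exact Subgroup.mem_sup_left (Subgroup.mem_map_of_mem _ hm)
      refine (Set.finite_range (QuotientGroup.lift N.toSubgroup _ hle)).subset ?_
      rintro _ ⟨v, hv, rfl⟩
      exact ⟨QuotientGroup.mk ⟨v, hv⟩, rfl⟩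
    · intro hxV
      obtain ⟨m, hm, z, hz, hmz⟩ := Subgroup.mem_sup.mp hxV
      obtain ⟨k, rfl⟩ := Subgroup.mem_zpowers_iff.mp hz
      have hk : ϖ ^ k ∈ UF := by
        have : ϖ ^ k = m⁻¹ * u := by rw [← hmz, inv_mul_cancel_left]
        rw [this]
        exact mul_mem (inv_mem (hMU hm)) hu
      obtain rfl := (zpow_mem_unitGroup_iff F hϖ k).mp hk
      rw [zpow_zero, mul_one] at hmz
      subst hmz
      obtain ⟨m', hm', hm'eq⟩ := Subgroup.mem_map.mp hm
      have : m' = u₀ := Subtype.ext hm'eq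
      subst this
      exact hN hm' rfl
  · -- `e ≠ 0`: `U_F · ϖ^{nℤ}` with `n = |e| + 1 ∤ e`
    refine ⟨UF ⊔ Subgroup.zpowers (ϖ ^ (e.natAbs + 1)), ?_, ?_, ?_⟩
    · exact Subgroup.isOpen_mono le_sup_left isOpen_unitGroup
    · refine finiteIndex_of_pow_mem F hϖ (Nat.succ_pos e.natAbs)
        (Subgroup.mem_sup_right (Subgroup.mem_zpowers _)) ?_
      refine (Set.finite_singleton (1 : Fˣ ⧸ (UF ⊔ Subgroup.zpowers (ϖ ^ (e.natAbs + 1))))).subset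
        ?_
      rintro _ ⟨v, hv, rfl⟩
      exact (QuotientGroup.eq_one_iff _).mpr (Subgroup.mem_sup_left hv)
    · intro hxV
      obtain ⟨m, hm, z, hz, hmz⟩ := Subgroup.mem_sup.mp hxV
      obtain ⟨k, rfl⟩ := Subgroup.mem_zpowers_iff.mp hz
      have h1 : ϖ ^ (e - (e.natAbs + 1 : ℕ) * k) ∈ UF := by
        have h2 : ϖ ^ (e - ((e.natAbs + 1 : ℕ) : ℤ) * k) = u⁻¹ * m := by
          rw [← zpow_natCast, ← zpow_mul] at hmz
          rw [zpow_sub, ← inv_mul_cancel_left u (ϖ ^ e), ← hmz, mul_assoc, mul_inv_cancel_right]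
        rw [h2]
        exact mul_mem (inv_mem hu) hm
      have h3 := (zpow_mem_unitGroup_iff F hϖ _).mp h1
      have h4 : e = (e.natAbs + 1 : ℕ) * k := by omega
      have hk0 : k ≠ 0 := by
        rintro rfl
        simp at h4
        exact he h4
      have h5 : e.natAbs = (e.natAbs + 1) * k.natAbs := by
        conv_lhs => rw [h4]
        rw [Int.natAbs_mul, Int.natAbs_natCast]
      have h6 : e.natAbs + 1 ≤ (e.natAbs + 1) * k.natAbs :=
        Nat.le_mul_of_pos_right _ (Int.natAbs_pos.mpr hk0)
      omega

/-- **`⋂ₙ (Fˣ)ⁿ = 1`**: an element of `Fˣ` with `n`-th roots for every `n ≥ 1` is `1` (it lies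
in every subgroup of finite index).
Ref: Serre, *Local Fields* (1979), Ch. XIV §6, proof of Cor. 2 (i). [folklore] -/
theorem eq_one_of_forall_exists_pow_eq (x : Fˣ) (h : ∀ n : ℕ, 0 < n → ∃ y : Fˣ, y ^ n = x) :
    x = 1 := by
  by_contra hx
  obtain ⟨U, -, hU, hxU⟩ := exists_isOpen_finiteIndex_notMem F hx
  obtain ⟨y, rfl⟩ := h U.index (Nat.pos_of_ne_zero Subgroup.FiniteIndex.index_ne_zero)
  exact hxU (U.pow_index_mem y)

/-- **The universal norm group is trivial**, from Serre's Prop. 6 of XI §5 (the named fact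
`universalNormSubgroup_divisible_and_eq F` of `LocalExistenceTheorem.lean`: `D_F ⊆ (Fˣ)ⁿ`, hence
`D_F` lies in every subgroup of finite index, `universalNormSubgroup_le_of_finiteIndex`).
Ref: Serre, *Local Fields* (1979), Ch. XIV §6, Cor. 2 (i). [folklore] -/
theorem universalNormSubgroup_eq_bot_of (h₃ : universalNormSubgroup_divisible_and_eq F) :
    universalNormSubgroup F = ⊥ := by
  rw [eq_bot_iff]
  intro x hx
  rw [Subgroup.mem_bot]
  by_contra hx1
  obtain ⟨U, -, hU, hxU⟩ := exists_isOpen_finiteIndex_notMem F hx1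
  exact hxU (universalNormSubgroup_le_of_finiteIndex h₃ U hx)

/-- **The universal norm group is trivial, from the existence theorem** (`localExistenceTheorem F`:
every open subgroup of finite index is a norm group; these separate points).
Ref: Serre, *Local Fields* (1979), Ch. XIV §6, Cor. 2 (i) to Thm. 1. [folklore] -/
theorem universalNormSubgroup_eq_bot_of_localExistenceTheorem (h : localExistenceTheorem F) :
    universalNormSubgroup F = ⊥ := by
  rw [eq_bot_iff]
  intro x hx
  rw [Subgroup.mem_bot]
  by_contra hx1
  obtain ⟨U, hUo, hU, hxU⟩ := exists_isOpen_finiteIndex_notMem F hx1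
  obtain ⟨E, hfd, hab, hE⟩ := h U hUo hU
  exact hxU (universalNormSubgroup_le F ⟨E, hfd, hab, hE⟩ hx)

/-- **The universal norm group is trivial, from a reciprocity system and the Lubin–Tate norm
groups**: the reciprocity law (`localReciprocityLaw_of_exists_isReciprocitySystem`) and the named
fact `exists_abelian_norm_le_lubinTate F` give the existence theorem
(`localExistenceTheorem_of_reciprocityLaw_of_lubinTate`, `LocalExistenceLubinTate.lean`).
Ref: Serre, *Local Fields* (1979), Ch. XIV §6, Cor. 2 (i); Cassels–Fröhlich Ch. VI §3.8.
[folklore] -/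
theorem universalNormSubgroup_eq_bot_of_lubinTate (h : exists_isReciprocitySystem F)
    (hLT : exists_abelian_norm_le_lubinTate F) : universalNormSubgroup F = ⊥ :=
  universalNormSubgroup_eq_bot_of_localExistenceTheorem F
    (localExistenceTheorem_of_reciprocityLaw_of_lubinTate F
      (localReciprocityLaw_of_exists_isReciprocitySystem h) hLT)

end UniversalNorm

section Assembly

universe u v

/-- **Existence of the reciprocity map from a reciprocity system** (the fact
`exists_isLocalReciprocityMap F` of `LocalReciprocity.lean`), given the triviality of the universal
norm group (norm groups are closed by `isClosed_of_isNormSubgroup_holds`,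
`LocalExistenceTheoremProofs`).
Ref: Serre, *Local Fields* (1979), Ch. XIII §4, Ch. XIV §6 (Cor. 2, Remark 2). [folklore] -/
theorem exists_isLocalReciprocityMap_of_isReciprocitySystem {F : Type u} [Field F]
    [ValuativeRel F] [TopologicalSpace F] [IsNonarchimedeanLocalField F]
    (h : exists_isReciprocitySystem F) (huniv : universalNormSubgroup F = ⊥) :
    exists_isLocalReciprocityMap F := by
  obtain ⟨ω, hω⟩ := h
  exact ⟨hω.theta, hω.isLocalReciprocityMap_theta huniv (isClosed_of_isNormSubgroup_holds F)⟩

/-- **The pair fact from the pair of systems**: `exists_isLocalReciprocityMap_normCompatible F E`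
(`LocalReciprocity.lean`) follows from `exists_isReciprocitySystem_normCompatible F E`
(`LocalReciprocityFinite.lean`) and the triviality of the universal norm groups of `F`, `E`.
Ref: Serre, *Local Fields* (1979), Ch. XIII §4, Prop. 10; Cassels–Fröhlich Ch. VI §2.4.
[folklore] -/
theorem exists_isLocalReciprocityMap_normCompatible_of_isReciprocitySystem {F : Type u}
    {E : Type v} [Field F] [ValuativeRel F] [TopologicalSpace F] [IsNonarchimedeanLocalField F]
    [Field E] [ValuativeRel E] [TopologicalSpace E] [IsNonarchimedeanLocalField E] [Algebra F E]
    [FiniteDimensional F E] [ValuativeExtension F E]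
    (h : exists_isReciprocitySystem_normCompatible F E)
    (hunivF : universalNormSubgroup F = ⊥) (hunivE : universalNormSubgroup E = ⊥) :
    exists_isLocalReciprocityMap_normCompatible F E := by
  obtain ⟨ωF, ωE, hF, hE, hN⟩ := h
  exact ⟨hF.theta, hE.theta,
    hF.isLocalReciprocityMap_theta hunivF (isClosed_of_isNormSubgroup_holds F),
    hE.isLocalReciprocityMap_theta hunivE (isClosed_of_isNormSubgroup_holds E),
    hF.isNormCompatible_theta hE hN⟩

/-- **`Literature.NumberTheory.GaloisRepresentations.exists_isCompatible` from the finite-level reciprocity systems and the norm-group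
inputs**: norm functoriality of the local Artin map on the Weil groups follows from the pair
facts `exists_isReciprocitySystem_normCompatible F E` (Serre XIII §4 / CF VI §2) for the finite
extensions `E/F` and the triviality of the universal norm groups (Serre XIV §6 Cor. 2 (i); norm
groups are closed by `isClosed_of_isNormSubgroup_holds`), via
`exists_isCompatible_of_localReciprocity` (`LocalClassFieldTheoryProofs.lean`) and the density
of the Weil groups (`WeilGroupDensityProofs.lean`).
Ref: Serre, *Local Fields* (1979), Ch. XIII §4, Prop. 10; Ch. XIV §6; Tate, Corvallis 1979,
(1.4.1)–(1.4.6); density of `W_F`: `WeilGroup.denseRange_toAbsGalois_holds`. [folklore] -/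
theorem exists_isCompatible_of_isReciprocitySystem {F : Type u} [Field F] [ValuativeRel F]
    [TopologicalSpace F] [IsNonarchimedeanLocalField F]
    (hunivF : universalNormSubgroup F = ⊥)
    (hrec : ∀ (E : Type v) [Field E] [ValuativeRel E] [TopologicalSpace E]
      [IsNonarchimedeanLocalField E] [Algebra F E] [FiniteDimensional F E] [ValuativeExtension F E],
      exists_isReciprocitySystem_normCompatible F E)
    (huniv : ∀ (E : Type v) [Field E] [ValuativeRel E] [TopologicalSpace E]
      [IsNonarchimedeanLocalField E] [Algebra F E] [FiniteDimensional F E] [ValuativeExtension F E],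
      universalNormSubgroup E = ⊥) :
    exists_isCompatible.{u, v} F :=
  exists_isCompatible_of_localReciprocity (WeilGroup.denseRange_toAbsGalois_holds F)
    (fun E _ _ _ _ => WeilGroup.denseRange_toAbsGalois_holds E) fun E _ _ _ _ _ _ _ =>
      exists_isLocalReciprocityMap_normCompatible_of_isReciprocitySystem (hrec E) hunivF (huniv E)

/-- **`Literature.NumberTheory.GaloisRepresentations.exists_isCompatible` from the finite-level reciprocity systems and Serre's XI §5
Prop. 6** (the named fact `universalNormSubgroup_divisible_and_eq`, for `F` and its finite
extensions), by `universalNormSubgroup_eq_bot_of`.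
Ref: Serre, *Local Fields* (1979), Ch. XI §5 Prop. 6, Ch. XIII §4 Prop. 10, Ch. XIV §6.
[folklore] -/
theorem exists_isCompatible_of_isReciprocitySystem_of_divisible {F : Type u} [Field F]
    [ValuativeRel F] [TopologicalSpace F] [IsNonarchimedeanLocalField F]
    (h₃F : universalNormSubgroup_divisible_and_eq F)
    (hrec : ∀ (E : Type v) [Field E] [ValuativeRel E] [TopologicalSpace E]
      [IsNonarchimedeanLocalField E] [Algebra F E] [FiniteDimensional F E] [ValuativeExtension F E],
      exists_isReciprocitySystem_normCompatible F E)
    (h₃ : ∀ (E : Type v) [Field E] [ValuativeRel E] [TopologicalSpace E]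
      [IsNonarchimedeanLocalField E] [Algebra F E] [FiniteDimensional F E] [ValuativeExtension F E],
      universalNormSubgroup_divisible_and_eq E) :
    exists_isCompatible.{u, v} F :=
  exists_isCompatible_of_isReciprocitySystem (universalNormSubgroup_eq_bot_of F h₃F) hrec
    fun E _ _ _ _ _ _ _ => universalNormSubgroup_eq_bot_of E (h₃ E)

/-- **`Literature.NumberTheory.GaloisRepresentations.exists_isCompatible` from the finite-level reciprocity systems and the Lubin–Tate
norm groups** (the named fact `exists_abelian_norm_le_lubinTate`, Cassels–Fröhlich VI §3, for `F`
and its finite extensions): the reciprocity systems give the reciprocity law, with the Lubin–Tate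
fact the existence theorem (`localExistenceTheorem_of_reciprocityLaw_of_lubinTate`), hence the
triviality of the universal norm groups.  This leaves, as inputs of `Literature.NumberTheory.GaloisRepresentations.exists_isCompatible`,
exactly the finite-level class field theory `exists_isReciprocitySystem_normCompatible` (Serre
XIII §4) and the Lubin–Tate norm computation.
Ref: Serre, *Local Fields* (1979), Ch. XIII §4, Ch. XIV §6; Cassels–Fröhlich (1967) Ch. VI
§2.4, §3.8. [folklore] -/
theorem exists_isCompatible_of_isReciprocitySystem_of_lubinTate {F : Type u} [Field F]
    [ValuativeRel F] [TopologicalSpace F] [IsNonarchimedeanLocalField F]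
    (hrec : ∀ (E : Type v) [Field E] [ValuativeRel E] [TopologicalSpace E]
      [IsNonarchimedeanLocalField E] [Algebra F E] [FiniteDimensional F E] [ValuativeExtension F E],
      exists_isReciprocitySystem_normCompatible F E)
    (hLTF : exists_abelian_norm_le_lubinTate F)
    (hLT : ∀ (E : Type v) [Field E] [ValuativeRel E] [TopologicalSpace E]
      [IsNonarchimedeanLocalField E] [Algebra F E] [FiniteDimensional F E] [ValuativeExtension F E],
      exists_abelian_norm_le_lubinTate E) :
    exists_isCompatible.{u, v} F :=
  exists_isCompatible_of_localReciprocity (WeilGroup.denseRange_toAbsGalois_holds F)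
    (fun E _ _ _ _ => WeilGroup.denseRange_toAbsGalois_holds E) fun E _ _ _ _ _ _ _ => by
      obtain ⟨ωF, ωE, hF, hE, hN⟩ := hrec E
      exact exists_isLocalReciprocityMap_normCompatible_of_isReciprocitySystem ⟨ωF, ωE, hF, hE, hN⟩
        (universalNormSubgroup_eq_bot_of_lubinTate F ⟨ωF, hF⟩ hLTF)
        (universalNormSubgroup_eq_bot_of_lubinTate E ⟨ωE, hE⟩ (hLT E))

end Assembly

end Literature.NumberTheory.GaloisRepresentations
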